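import Literature.NumberTheory.GaloisRepresentations.LocalReciprocityNormFunctoriality
import HarnessLib

/-!
# The local reciprocity map exists: discharge of `exists_isLocalReciprocityMap`

This file discharges the named fact
`Literature.NumberTheory.GaloisRepresentations.exists_isLocalReciprocityMap F`
(`LocalReciprocity.lean`): for every non-archimedean local field `F` there is a homomorphism
`θ : Fˣ →* Γ_F^ab = G(F^ab/F)` with the printed properties of Serre's reciprocity map
`x ↦ (x, */F)` — injective, image `𝔄_F^0` (the image of the Weil group), units `U_F` mapped
isomorphically and homeomorphically onto the inertia group `𝔗_F`, uniformisers sent to arithmetic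
Frobenius classes (Serre, *Local Fields*, Ch. XIII §4 Prop. 13 and Cor.; Ch. XIV §6 Thm. 1,
Cor. 2 (i)–(iii) and Remark 2, pp. 218–220 of the book).

## The proof in the tree versus the printed proof

Serre obtains `θ_F` from the class formation `(G_F, F_s^*)` (XIII §4 Thm. 1: `inv_E : Br(E) ≅ ℚ/ℤ`
through the unramified Brauer group), the finite symbols `(x, L/F)` being the inverses of the
cup-product isomorphisms `G^a_{L/F} ≅ Fˣ/N Lˣ` with the fundamental classes (Cor. to Thm. 1,
Prop. 8 Cor., Props. 10–13), and then passes to the limit using the existence theorem (XIV §6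
Thm. 1, from the abstract existence theorem XI §5 Thm. 2) and its Cor. 2: the norm groups
intersect in `{1}` and `U_F → 𝔗_F` is a topological isomorphism.

Mathlib (this pin) has no Brauer groups of local fields, cup products or class formations, so the
tree reaches the same two stages by a different published route, all of it already landed:

1. **Finite level** (`exists_isReciprocitySystem F`, `LocalReciprocityFinite.lean`: surjective
   symbols `ω_L : Fˣ → G(L/F)` with kernel `N_{L/F} Lˣ`, compatible in towers, units onto inertia,
   `(ϖ, L/F) = F_F` on unramified `L`) is `LocalWeilDatum.exists_isReciprocitySystem_holds`
   (`LocalReciprocityNormFunctoriality.lean`): Neukirch's cohomology-free abstract class field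
   theory (*Algebraic Number Theory*, Ch. IV §§4–6) applied to the Weil datum of `F`
   (`localWeilDatum F`), whose class field axiom is Neukirch V (1.1) — the `H⁰` part
   `cyclicNormIndexEq_holds` (`LocalClassFieldAxiom.lean`) and the `H⁻¹` part Hilbert 90 — giving
   the reciprocity law IV (6.3) and its functorial properties.
2. **Passage to the limit** (`exists_isLocalReciprocityMap_of_exists_isReciprocitySystem`,
   `LocalCFTFromReciprocitySystem.lean`, assembled in `LocalReciprocityLimitProofs.lean` and
   `LocalReciprocityThetaProofs.lean`): the compatible system defines `θ_F : Fˣ → Γ_F^ab`; its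
   printed properties need exactly Serre's two norm-group inputs, both theorems of the tree —
   norm groups are closed (`isClosed_of_isNormSubgroup_holds`, `LocalExistenceTheoremProofs.lean`)
   and the universal norm group is trivial (`universalNormSubgroup_eq_bot`, from the Lubin–Tate
   norm groups, `LubinTateNormGroup.lean`; Serre XIV §6 Cor. 2 (i)).

The theorem below is the composition of 1 and 2; nothing new is asserted.  (Equivalently it is
the first component of the already discharged pair fact
`LocalWeilDatum.exists_isLocalReciprocityMap_normCompatible_holds F F`,
`LocalReciprocityNormFunctorialityInsep.lean`; the direct composition keeps the imports lighter.)

## References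

* J.-P. Serre, *Local Fields*, GTM 67, Springer 1979, Ch. XIII §4 (Thm. 1, Prop. 8 Cor.,
  Props. 10–13 and Cor.), Ch. XIV §6 (Thm. 1, Cor. 2, Remark 2).  [SerreLocalFields1979]
* J. Neukirch, *Algebraic Number Theory*, Grundlehren 322, Springer 1999, Ch. IV §6 (6.3),
  Ch. V §1 (1.1), (1.3).  [NeukirchANT1999]
-/

noncomputable section

namespace Literature.NumberTheory.GaloisRepresentations

universe u

/-- **Local class field theory: the reciprocity map exists** — discharge of the named fact
`exists_isLocalReciprocityMap F`: for a non-archimedean local field `F` there is a homomorphism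
`θ : Fˣ →* G(F^ab/F)` which is injective, has image `𝔄_F^0` (the image of the Weil group), maps
`U_F` homeomorphically onto the inertia group `𝔗_F`, and sends uniformisers to arithmetic
Frobenius classes (`IsLocalReciprocityMap F θ`).  Obtained from the finite-level reciprocity
system of `F` (`LocalWeilDatum.exists_isReciprocitySystem_holds`, Neukirch's route) by passage to
the limit (`exists_isLocalReciprocityMap_of_exists_isReciprocitySystem`, using that norm groups are
closed and universal norms are trivial).
Ref: Serre, *Local Fields* (1979), Ch. XIII §4 Thm. 1, Prop. 13 and Cor.; Ch. XIV §6 Thm. 1,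
Cor. 2 (i)–(iii), Remark 2; Neukirch, *Algebraic Number Theory* (1999), Ch. V §1 Thm. (1.3).
[cite: SerreLocalFields1979, Ch. XIV §6 Thm. 1 Cor. 2 and Remark 2] -/
theorem exists_isLocalReciprocityMap_holds (F : Type u) [Field F] [ValuativeRel F]
    [TopologicalSpace F] [IsNonarchimedeanLocalField F] : exists_isLocalReciprocityMap F :=
  exists_isLocalReciprocityMap_of_exists_isReciprocitySystem F
    (LocalWeilDatum.exists_isReciprocitySystem_holds F)

end Literature.NumberTheory.GaloisRepresentations
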